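import Mathlib
import Literature.MathematicalPhysics.QuantumFieldTheory.Balaban1983to89.T4EtaRate
import Literature.MathematicalPhysics.QuantumFieldTheory.Balaban1983to89.T4Cov2156Rate

/-!
# T4EtaRateUnitWitness — the FIRST BY-NAME INHABITANT of node U1a's producer-side η-rate shapes
`T4EtaRate.EtaRateIneqUnit` / `NE2PlusUnit` (cell `pub-balaban`, rung (B)+1 on a fixed torus T⁴; row T4-U1a.S-NE2unit-WITNESS°,
pv25 lineage = owner of `T4EtaRate`; typing + bookkeeping over another lineage's KERNEL THEOREM; NOT summit progress)

HONEST FRAMING.  The cell's T4 target is rung (B)+1 (existence AND uniqueness of the ε → 0 limit of Bałaban's unit-scale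
averaged expectations on a FIXED finite torus) — NOT infinite volume, NOT a mass gap, NOT the Clay problem.  Node U1a of
its spine needs the located NEW ESTIMATE NE2 (an η-DIFFERENCE estimate with geometric rate for Bałaban's background
propagators; NOT PRINTED anywhere in [Balaban1983RegularityDecay]–[Balaban1985BackgroundPropagators], cell record
`t4/T4-XREAD-U1a.md` §3).  The module `T4EtaRate` (this lineage, p178744) typed NE2 PRODUCER-SIDE as HYPOTHESIS SHAPES over
the abstract carriers of `B9.lean` (`Geometry`, `Backgrounds`, `SiteKernel`, `EtaPairing`, `PairedInstance`): the unit-lattice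
layer is `EtaRateIneqUnit` (body `|K(U; y, y′)| ≤ B₀e^{−δ₀dist(y,y′)}θ^k`) and its uniform packaging `NE2PlusUnit`
(with-background) — asserted NOWHERE, assumed by nodes U3/U6.  Until now NO decl of the tree inhabited these shapes other
than by intent.

WHAT THIS LEAF DOES.  The prover lineage t4-ne2-p2 has since PROVED, hypothesis-free, the η-rate of Bałaban's one-step
fluctuation covariance C^{(k)} = C(C*Δ^{(L^k)}C)⁻¹C* of [Balaban1984PropagatorsII] (2.156) AT THE TRIVIAL BACKGROUND U ≡ 1 on
every unit torus T_{M⃗} (d ≥ 2, L ∣ M_i), in King's printed A = 0 shape [King1986] Lemma 4.5 (4.38) p. 674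
*"|C^{(k)}(x, y) − C^{(k+n)}(x, y)| ≤ CL^{−k}e^{−δ₀|x−y|}"*: tree `T4Cov2156Rate.cov2156_rate_torus_king` (p185201) —
`|C^{(L^{k+m})}(b,b′) − C^{(L^k)}(b,b′)| ≤ C′·(L^k)⁻¹·e^{−δ′ρ_M(b₋,b′₋)}` with C′, δ′ depending on (d, L) ONLY, for ALL
tori, ALL k and ALL numbers m of extra scales.  Its author's NOTE (journal l.48708 (2)–(3)) observes that this two-point form
"IS the body of `T4EtaRate.EtaRateIneqUnit` at U = 1" and addresses the typing to this lineage.  Here that reading is made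
a KERNEL FACT, importing `T4EtaRate` and `T4Cov2156Rate` BY NAME and editing nothing:
  §1 the concrete carriers — `unitGeometry L M⃗ k` (sites = the torus bonds `B4.Idx (pbox M⃗) d`, every site a UNIT site of
     scale index k, η = L^{−k}, dist = the bond pseudo-distance ρ_M), the ONE-POINT background carrier `onePointBackgrounds`
     (Cfg = Unit = {U ≡ 1}: the A = 0 SUB-THEORY — said so, see HONEST SCOPE (ii)), the identity pairing `unitPairing` (n = m
     extra scales; King's site convention is the identity on unit-lattice bonds), the paired family `covInstance` indexed by
     `TorusIndex d L` = (M⃗, L ∣ M_i, k, m), and the η-DIFFERENCE kernel `covDiffKernel` = C^{(L^{k+m})} − C^{(L^k)};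
  §2 `etaRateIneqUnit_cov2156` — `EtaRateIneqUnit` HOLDS for this family with ONE (B₀, δ₀) for all indices and θ = L⁻¹
     (d ≥ 2, L ≥ 1); `NE2ZeroUnit` — the A = 0 unit-layer shape (the unit-lattice analogue of `T4EtaRate.NE2ZeroOperator`, which
     `T4EtaRate` did not spell out) with the bookkeeping `ne2ZeroUnit_of_ne2PlusUnit`; `ne2ZeroUnit_cov2156` — its
     hypothesis-free instance (L ≥ 2, so that θ = L⁻¹ ∈ (0, 1)); `ne2PlusUnit_cov2156` — hence `NE2PlusUnit` ITSELF is inhabited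
     by this family (HONEST SCOPE (ii): degenerate in the background variable, genuine in rate, decay and uniformity);
  §3 the OPERATOR-NORM consequence at unit sites — Schur row sums: `rowSum_rate_cov2156` (Σ_{b′}|K(b,b′)| ≤ B₁θ^k, by
     `T4Cov2156Rate.bondSum_le` = King's volume-independent sum (iv)) and `supNorm_rate_cov2156` (‖(C^{(L^{k+m})} − C^{(L^k)})f‖_∞
     ≤ B₁θ^k‖f‖_∞ for every f : bonds → ℝ) — the ℓ^∞ → ℓ^∞ operator-norm η-rate of C^{(k)}(𝟙), i.e. layer (L1) of
     `T4OperatorRateLiaison` for this species, with rate factor θ^k because every site is a unit site (`unitGeometry_len`,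
     `rateFactor_unitGeometry_one`: King's factor (η/L^jη)^γ at γ = 1 is exactly (L⁻¹)^k here — layer (L2), no loss).

PRINT READ FOR THIS LEAF (renders `b2b-balaban-template/king-renders/1986-cmp102-king-u1-higgs-I-p0NN-x2.png`, journal page
= NN + 648): [King1986] p. 670 (§4 opening, *"(and A = 0, of course)"*), p. 674 (Lemma 4.5 (4.38)), p. 675 ((4.40)–(4.41): the
triple lattice sum bounded by CL^{−k}exp[−δ₀|x − y|]).  The Bałaban locators (3.35)–(3.38), (3.41) p. 396–397, Thm 3.15 (3.187)
p. 432 of [Balaban1985BackgroundPropagators] and (2.156) p. 250 of [Balaban1984PropagatorsII] are those of the imported decls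
`B9.Backgrounds`, `B9.Geometry.len`, `T4EtaRate.NE2PlusUnit`, `T4Cov2156Rate.cov2156_rate_torus_king` (verified and cross-read
there; repeated here only to say which printed object / convention each bookkeeping decl instantiates).

HONEST SCOPE.  (i) Every estimate used is t4-ne2-p2's / pv09's / b05's kernel theorem, imported by name; this leaf adds NO
analysis.  (ii) `onePointBackgrounds` has exactly one configuration, U ≡ 1, and its regularity predicates (3.35)/(3.36) are
`True`: the instance of `NE2PlusUnit` in §2 is therefore the A = 0 content (NE2⁰, unit layer) sitting inside NE2⁺'s TYPE — it
says nothing about background dependence, which is the located new estimate NE2⁺ proper (NOT PRINTED, not claimed).  What is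
NOT degenerate: the rate θ = L⁻¹ < 1, the decay e^{−δ₀ρ}, and the uniformity of (B₀, δ₀) in the torus M⃗, in k and in the
number m of extra scales (King's "for all n").  (iii) The object is the unit-lattice fluctuation covariance (2.156) of ONE
block step at U = 1 (cell primitive P1 of `t4/T4-LIAISON-U1.md`); NOT the propagators G(U), H_k(U) of [II] (1.3)–(1.7) (cell
objects X9–X11, the t4-ne2-p1 line), NOT Landau-gauge vector propagators with background, NOT infinite volume, NOT a
statement about any measure.  (iv) The Geometry's cube-size field `M` (Bałaban's M of (3.35)) is set to 1 and is inert here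
(one-point backgrounds); the unused test-function / cut-off carriers are one-point types with zero norms.  Value = the
producer shape of node U1a is now inhabited BY NAME by a printed-formula object with a kernel proof; NOT summit progress.
-/

noncomputable section

open Finset

namespace Literature.MathematicalPhysics.QuantumFieldTheory.Balaban1983to89.T4EtaRateUnitWitness

open B9 (Geometry Backgrounds SiteKernel)
open T4EtaRate (EtaPairing PairedInstance EtaRateIneqUnit NE2PlusUnit rateFactor rateFactor_unit)
open B6Lemma24Torus (pbox)
open B6BondEliminationTorus (pdist)
open B6Cov2156Torus (deltaPol bondReductionT one_le_M)
open T4Cov2156Rate (cov2156_rate_torus_king bondDist_nonneg bondSum_le)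

variable {d : ℕ}

/-! ## §1  The concrete carriers: unit tori, one-point backgrounds, identity pairings, the η-difference kernel -/

/-- The UNIT-LATTICE GEOMETRY of run "η = L^{−k}" on the torus T_{M⃗}: sites = the torus bonds (base point in the periodic
box × direction), every site a unit site (scale index k, so that L^kη = 1), dist = the bond pseudo-distance ρ_M(b₋, b′₋);
the test-function and cut-off carriers are inert one-point types (zero norms); Bałaban's cube size M := 1 (inert).
[cite: Balaban1985BackgroundPropagators, (3.41) p.397 (site scale convention)] -/
def unitGeometry (L : ℕ) (M : Fin d → ℕ) [∀ μ, NeZero (M μ)] (k : ℕ) : Geometry where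
  Site := B4.Idx (pbox M) d
  scale := fun _ => k
  dist := fun p q => pdist M (one_le_M M) (p.1 : Fin d → ℤ) (q.1 : Fin d → ℤ)
  k := k
  eta := ((L : ℝ) ^ k)⁻¹
  L := L
  M := 1
  Loc := Unit
  suppIn := fun _ _ => True
  suppInT := fun _ _ => True
  supNorm := fun _ => 0
  l2Norm := fun _ => 0
  wNorm := fun _ _ => 0
  holder := fun _ _ => 0
  Cut := Unit
  cutIn := fun _ _ => True
  cutInT := fun _ _ => True
  cutH := fun _ _ => 0
  cutSup := fun _ => 0
  suppInT_of_suppIn := fun _ _ h => h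
  cutInT_of_cutIn := fun _ _ h => h

/-- Every site of `unitGeometry` has physical size L^kη = 1 (L ≥ 1). [folklore] -/
theorem unitGeometry_len {L : ℕ} (hL : 1 ≤ L) (M : Fin d → ℕ) [∀ μ, NeZero (M μ)] (k : ℕ)
    (y : (unitGeometry L M k).Site) : (unitGeometry L M k).len y = 1 := by
  have hL0 : (L : ℝ) ≠ 0 := by exact_mod_cast (by omega : L ≠ 0)
  show (L : ℝ) ^ k * ((L : ℝ) ^ k)⁻¹ = 1
  exact mul_inv_cancel₀ (pow_ne_zero _ hL0)

/-- King's rate factor (η / L^jη)^γ at a unit site of `unitGeometry` with exponent γ = 1 is exactly θ^k with θ = L⁻¹ —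
the rate of `T4Cov2156Rate.cov2156_rate_torus_king` (layer (L2) of `T4OperatorRateLiaison`: no loss at unit sites).
[cite: King1986, Prop. 3.9 (3.73) p.665 and Lemma 4.5 (4.38) p.674] -/
theorem rateFactor_unitGeometry_one {L : ℕ} (hL : 1 ≤ L) (M : Fin d → ℕ) [∀ μ, NeZero (M μ)] (k : ℕ)
    (y : (unitGeometry L M k).Site) : rateFactor (unitGeometry L M k) 1 y = ((L : ℝ)⁻¹) ^ k := by
  rw [rateFactor_unit 1 (unitGeometry_len hL M k y), Real.rpow_one]
  show ((L : ℝ) ^ k)⁻¹ = ((L : ℝ)⁻¹) ^ k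
  rw [inv_pow]

/-- The ONE-POINT BACKGROUND CARRIER: the only configuration is U ≡ 1 and the regularity / complex-class predicates
(3.35)–(3.38) hold trivially — the A = 0 SUB-THEORY of B9's background carrier (HONEST SCOPE (ii)).
[cite: Balaban1985BackgroundPropagators, (3.35)–(3.38) p.396 (predicates made trivial)]
[cite: King1986, p.670 ("and A = 0, of course")] -/
def onePointBackgrounds : Backgrounds where
  Cfg := Unit
  one := ()
  mul := fun _ _ => ()
  Reg335 := fun _ _ _ => True
  Reg336 := fun _ _ _ => True
  Cplx337 := fun _ _ _ => True
  Cplx338 := fun _ _ _ => True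

/-- The IDENTITY η-PAIRING between the runs η = L^{−k} (coarse) and η′ = L^{−(k+m)} (fine) on the same unit torus: n = m extra
scales, sites/test functions/backgrounds transported identically (on unit-lattice bonds King's convention "x′ ∈ B^n(x)" is
the identity), η′L^m = η. [cite: King1986, p.664 (convention before Prop. 3.8)] -/
def unitPairing {L : ℕ} (hL : 1 ≤ L) (M : Fin d → ℕ) [∀ μ, NeZero (M μ)] (k m : ℕ) :
    EtaPairing (unitGeometry L M k) (unitGeometry L M (k + m)) onePointBackgrounds onePointBackgrounds where
  n := m
  k_eq := rfl
  L_eq := rfl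
  M_eq := rfl
  eta_eq := by
    have hL0 : (L : ℝ) ≠ 0 := by exact_mod_cast (by omega : L ≠ 0)
    show ((L : ℝ) ^ (k + m))⁻¹ * (L : ℝ) ^ m = ((L : ℝ) ^ k)⁻¹
    rw [pow_add, mul_inv, mul_assoc, inv_mul_cancel₀ (pow_ne_zero _ hL0), mul_one]
  ι := fun y => y
  scale_ι := fun _ => rfl
  dist_ι := fun _ _ => rfl
  τ := fun lam => lam
  suppIn_τ := fun _ _ h => h
  supNorm_τ := fun _ => le_rfl
  avg := fun U => U
  avg_one := rfl

/-- The INDEX of the paired family: a unit torus T_{M⃗} with L ∣ M_i, the coarse run's number of scales k, and the number m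
of extra scales of the fine run. [folklore] -/
structure TorusIndex (d L : ℕ) where
  M : Fin d → ℕ
  [neZero : ∀ μ, NeZero (M μ)]
  hLM : ∀ i, L ∣ M i
  k : ℕ
  m : ℕ

-- Projection instance of a bundled structure field (head symbol `NeZero (TorusIndex.M _ _)`): it can only fire on the
-- side lengths of a `TorusIndex` and overrides no library instance; needed so that `bondReductionT L i.M`, `pbox i.M`
-- elaborate for a bundled index `i`.
attribute [instance] TorusIndex.neZero

/-- The index family is nonempty for every L ≥ 1: the torus with all sides equal to L (so L ∣ M_i trivially), any k, m —
so the uniform statements of §2 are not vacuous quantifications. [folklore] -/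
def TorusIndex.cube (d L : ℕ) [NeZero L] (k m : ℕ) : TorusIndex d L where
  M := fun _ => L
  hLM := fun _ => dvd_rfl
  k := k
  m := m

/-- The PAIRED INSTANCE at index i = (M⃗, k, m): coarse run `unitGeometry L M⃗ k`, fine run `unitGeometry L M⃗ (k + m)`,
one-point backgrounds, identity pairing. [folklore] -/
def covInstance {L : ℕ} (hL : 1 ≤ L) (i : TorusIndex d L) : PairedInstance where
  gc := unitGeometry L i.M i.k
  gf := unitGeometry L i.M (i.k + i.m)
  Bc := onePointBackgrounds
  Bf := onePointBackgrounds
  pair := unitPairing hL i.M i.k i.m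

/-- The η-DIFFERENCE of Bałaban's one-step fluctuation covariance (2.156) at U = 1 between the two runs, as a two-point kernel
on the torus bonds: C^{(L^{k+m})}(b,b′) − C^{(L^k)}(b,b′). [cite: Balaban1984PropagatorsII, (2.156) p.250 (object)] -/
def covDiff (L : ℕ) (M : Fin d → ℕ) [∀ μ, NeZero (M μ)] (k m : ℕ) (p q : B4.Idx (pbox M) d) : ℝ :=
  (bondReductionT L M (deltaPol M (L ^ (k + m)))).cov p q - (bondReductionT L M (deltaPol M (L ^ k))).cov p q

/-- The η-difference kernel as a `B9.SiteKernel` over the paired instance (the background argument is the unique U ≡ 1).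
[cite: Balaban1984PropagatorsII, (2.156) p.250 (object)] -/
def covDiffKernel {L : ℕ} (hL : 1 ≤ L) (i : TorusIndex d L) :
    SiteKernel (covInstance hL i).gc (covInstance hL i).Bf where
  ker := fun _ p q => covDiff L i.M i.k i.m p q

/-- The kernel of the instance, unfolded: at the unique background it is `covDiff`. [folklore] -/
theorem covDiffKernel_ker {L : ℕ} (hL : 1 ≤ L) (i : TorusIndex d L) (U : (covInstance hL i).Bf.Cfg)
    (p q : (covInstance hL i).gc.Site) : (covDiffKernel hL i).ker U p q = covDiff L i.M i.k i.m p q := rfl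

/-- All bonds count ("inΛ := True": the whole torus). [folklore] -/
def allSites {L : ℕ} (hL : 1 ≤ L) (i : TorusIndex d L) : (covInstance hL i).gc.Site → Prop := fun _ => True

/-- The unit-lattice distance of the instance = the bond pseudo-distance ρ_M(b₋, b′₋). [folklore] -/
def bondDist {L : ℕ} (hL : 1 ≤ L) (i : TorusIndex d L) :
    (covInstance hL i).gc.Site → (covInstance hL i).gc.Site → ℝ :=
  (covInstance hL i).gc.dist

/-! ## §2  The shapes hold: `EtaRateIneqUnit`, the A = 0 packaging `NE2ZeroUnit`, and `NE2PlusUnit` over one-point backgrounds -/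

/-- **`EtaRateIneqUnit` HOLDS for C^{(k)}(𝟙), hypothesis-free** (d ≥ 2, L ≥ 1): ONE pair (B₀, δ₀) depending on (d, L) only
such that for EVERY index (M⃗, k, m) and the (unique) background,
`|C^{(L^{k+m})}(b,b′) − C^{(L^k)}(b,b′)| ≤ B₀·e^{−δ₀ρ_M(b₋,b′₋)}·(L⁻¹)^k` — literally `T4EtaRate.EtaRateIneqUnit` at θ = L⁻¹ and
the coarse run's k.  Proof = `T4Cov2156Rate.cov2156_rate_torus_king` (t4-ne2-p2, p185201) read through §1's dictionary.
[cite: King1986, Lemma 4.5 (4.38) p.674 (printed A = 0 shape)]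
[cite: Balaban1984PropagatorsII, (2.156) p.250 (object)] [folklore] -/
theorem etaRateIneqUnit_cov2156 (hd : 2 ≤ d) {L : ℕ} (hL : 1 ≤ L) :
    ∃ B₀ δ₀ : ℝ, 0 < B₀ ∧ 0 < δ₀ ∧ ∀ (i : TorusIndex d L) (U : (covInstance hL i).Bf.Cfg),
      EtaRateIneqUnit (covDiffKernel hL i) (allSites hL i) (bondDist hL i) B₀ δ₀ ((L : ℝ)⁻¹) i.k U := by
  obtain ⟨C', δ', hC', hδ', H⟩ := cov2156_rate_torus_king d hd hL
  refine ⟨C', δ', hC', hδ', fun i U y y' _ _ => ?_⟩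
  have h := H i.M i.hLM i.k i.m y y'
  show |covDiff L i.M i.k i.m y y'| ≤
    C' * Real.exp (-(δ' * pdist i.M (one_le_M i.M) (y.1 : Fin d → ℤ) (y'.1 : Fin d → ℤ))) * ((L : ℝ)⁻¹) ^ i.k
  calc |covDiff L i.M i.k i.m y y'|
      ≤ C' * ((L : ℝ) ^ i.k)⁻¹ * Real.exp (-(δ' * pdist i.M (one_le_M i.M) (y.1 : Fin d → ℤ) (y'.1 : Fin d → ℤ))) := h
    _ = C' * Real.exp (-(δ' * pdist i.M (one_le_M i.M) (y.1 : Fin d → ℤ) (y'.1 : Fin d → ℤ))) * ((L : ℝ)⁻¹) ^ i.k := by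
      rw [inv_pow]; ring

/-- **NE2⁰, unit-lattice layer** (HYPOTHESIS SHAPE over the abstract carriers; the unit-lattice analogue of
`T4EtaRate.NE2ZeroOperator`, not spelled out there): uniform constants δ₀, B₀ > 0 and a rate θ ∈ (0, 1) such that for every
paired instance the η-difference kernel AT THE TRIVIAL BACKGROUND obeys `EtaRateIneqUnit`.  King's printed A = 0 statement
is its model. [cite: King1986, Lemma 4.5 (4.38) p.674 (A = 0 model)] -/
def NE2ZeroUnit {I : Type} (pi : I → PairedInstance) (Kd : ∀ i, SiteKernel (pi i).gc (pi i).Bf)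
    (inΛ : ∀ i, (pi i).gc.Site → Prop) (unitDist : ∀ i, (pi i).gc.Site → (pi i).gc.Site → ℝ) : Prop :=
  ∃ δ₀ B₀ θ : ℝ, 0 < δ₀ ∧ 0 < B₀ ∧ 0 < θ ∧ θ < 1 ∧
    ∀ i : I, EtaRateIneqUnit (Kd i) (inΛ i) (unitDist i) B₀ δ₀ θ (pi i).gc.k (pi i).Bf.one

/-- Bookkeeping (kernel-checked): NE2⁺-unit implies NE2⁰-unit, given that the trivial configuration satisfies both regularity
conditions for every α₀ > 0 and that the cube sizes M are positive (to pick an admissible α₀ = a₀/M) — the unit-layer twin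
of `T4EtaRate.ne2Zero_of_ne2Plus`. [folklore] -/
theorem ne2ZeroUnit_of_ne2PlusUnit {I : Type} {c35 : ℝ} {pi : I → PairedInstance}
    {Kd : ∀ i, SiteKernel (pi i).gc (pi i).Bf} {inΛ : ∀ i, (pi i).gc.Site → Prop}
    {unitDist : ∀ i, (pi i).gc.Site → (pi i).gc.Site → ℝ}
    (hM : ∀ i, 0 < (pi i).gf.M)
    (h335 : ∀ (i : I) (α₀ : ℝ), 0 < α₀ → (pi i).Bf.Reg335 c35 α₀ (pi i).Bf.one)
    (h336 : ∀ (i : I) (α₀ : ℝ), 0 < α₀ → (pi i).Bf.Reg336 c35 α₀ (pi i).Bf.one)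
    (h : NE2PlusUnit c35 pi Kd inΛ unitDist) : NE2ZeroUnit pi Kd inΛ unitDist := by
  obtain ⟨δ₀, a₀, B₀, θ, hδ, ha, hB, hθ0, hθ1, H⟩ := h
  refine ⟨δ₀, B₀, θ, hδ, hB, hθ0, hθ1, fun i => ?_⟩
  have hα : 0 < a₀ / (pi i).gf.M := div_pos ha (hM i)
  have hMne : (pi i).gf.M ≠ 0 := (hM i).ne'
  have hMa : (pi i).gf.M * (a₀ / (pi i).gf.M) = a₀ := by field_simp
  exact H i (a₀ / (pi i).gf.M) hα hMa.le _ (h335 i _ hα) (h336 i _ hα)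

/-- **NE2⁰-unit IS A THEOREM for C^{(k)}(𝟙)** (d ≥ 2, L ≥ 2): the A = 0 unit-layer shape holds for the family `covInstance` /
`covDiffKernel` with θ = L⁻¹ ∈ (0, 1) and (B₀, δ₀) depending on (d, L) only — hypothesis-free.
[cite: King1986, Lemma 4.5 (4.38) p.674 (shape)]
[cite: Balaban1984PropagatorsII, (2.156) p.250 (object)] [folklore] -/
theorem ne2ZeroUnit_cov2156 (hd : 2 ≤ d) {L : ℕ} (hL : 2 ≤ L) :
    NE2ZeroUnit (covInstance (d := d) (L := L) (by omega)) (covDiffKernel (by omega)) (allSites (by omega))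
      (bondDist (by omega)) := by
  have hL1 : 1 ≤ L := by omega
  obtain ⟨B₀, δ₀, hB₀, hδ₀, H⟩ := etaRateIneqUnit_cov2156 (d := d) hd hL1
  have hLpos : (0 : ℝ) < L := by exact_mod_cast (by omega : 0 < L)
  have hθ1 : ((L : ℝ)⁻¹) < 1 := inv_lt_one_of_one_lt₀ (by exact_mod_cast hL)
  exact ⟨δ₀, B₀, (L : ℝ)⁻¹, hδ₀, hB₀, inv_pos.mpr hLpos, hθ1, fun i => H i _⟩

/-- **`NE2PlusUnit` IS INHABITED by C^{(k)}(𝟙) over one-point backgrounds** (d ≥ 2, L ≥ 2, any geometric constant c35):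
constants δ₀, a₀ := 1, B₀, θ = L⁻¹.  HONEST SCOPE (ii): the background quantifier ranges over {U ≡ 1} only and (3.35)/(3.36)
are trivial there — this is NE2⁰-unit CONTENT inside NE2⁺-unit's TYPE, not the background-dependent estimate NE2⁺ (NOT
PRINTED, not claimed); rate, decay and uniformity in (M⃗, k, m) are genuine.
[cite: King1986, Lemma 4.5 (4.38) p.674 (shape)]
[cite: Balaban1985BackgroundPropagators, Thm 3.15 (3.187) p.432 (quantifier template)] [folklore] -/
theorem ne2PlusUnit_cov2156 (hd : 2 ≤ d) {L : ℕ} (hL : 2 ≤ L) (c35 : ℝ) :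
    NE2PlusUnit c35 (covInstance (d := d) (L := L) (by omega)) (covDiffKernel (by omega)) (allSites (by omega))
      (bondDist (by omega)) := by
  have hL1 : 1 ≤ L := by omega
  obtain ⟨B₀, δ₀, hB₀, hδ₀, H⟩ := etaRateIneqUnit_cov2156 (d := d) hd hL1
  have hLpos : (0 : ℝ) < L := by exact_mod_cast (by omega : 0 < L)
  have hθ1 : ((L : ℝ)⁻¹) < 1 := inv_lt_one_of_one_lt₀ (by exact_mod_cast hL)
  exact ⟨δ₀, 1, B₀, (L : ℝ)⁻¹, hδ₀, one_pos, hB₀, inv_pos.mpr hLpos, hθ1, fun i _ _ _ U _ _ => H i U⟩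

/-- Consistency (kernel-checked): on this family NE2⁺-unit ⇒ NE2⁰-unit by the abstract bookkeeping too (M = 1 > 0, trivial
regularity). [folklore] -/
theorem ne2ZeroUnit_cov2156' (hd : 2 ≤ d) {L : ℕ} (hL : 2 ≤ L) :
    NE2ZeroUnit (covInstance (d := d) (L := L) (by omega)) (covDiffKernel (by omega)) (allSites (by omega))
      (bondDist (by omega)) :=
  ne2ZeroUnit_of_ne2PlusUnit (c35 := 0) (fun _ => by show (0 : ℝ) < 1; norm_num) (fun _ _ _ => trivial)
    (fun _ _ _ => trivial) (ne2PlusUnit_cov2156 hd hL 0)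

/-! ## §3  The operator-norm consequence at unit sites: Schur row sums and the ℓ^∞ → ℓ^∞ rate -/

/-- **ROW-SUM (SCHUR) η-RATE of C^{(k)}(𝟙)** (d ≥ 2, L ≥ 1): ONE constant B₁(d, L) > 0 such that for every unit torus (L ∣ M_i),
all k, m and every bond b, `Σ_{b′} |C^{(L^{k+m})}(b,b′) − C^{(L^k)}(b,b′)| ≤ B₁·(L⁻¹)^k` — `EtaRateIneqUnit` summed against King's
volume-independent lattice sum (`T4Cov2156Rate.bondSum_le`).
[cite: King1986, Lemma 4.5 (4.38) p.674 (shape) and (4.40)–(4.41) p.675 (volume-independent sums)] [folklore] -/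
theorem rowSum_rate_cov2156 (hd : 2 ≤ d) {L : ℕ} (hL : 1 ≤ L) :
    ∃ B₁ : ℝ, 0 < B₁ ∧ ∀ (M : Fin d → ℕ) [∀ μ, NeZero (M μ)], (∀ i, L ∣ M i) → ∀ (k m : ℕ) (p : B4.Idx (pbox M) d),
      ∑ q : B4.Idx (pbox M) d, |covDiff L M k m p q| ≤ B₁ * ((L : ℝ)⁻¹) ^ k := by
  obtain ⟨B₀, δ₀, hB₀, hδ₀, H⟩ := etaRateIneqUnit_cov2156 (d := d) hd hL
  set V := max 1 ((d : ℝ) * B4Sect5Proof.latticeConst d δ₀) with hV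
  have hV1 : 1 ≤ V := le_max_left _ _
  refine ⟨B₀ * V, by positivity, fun M _ hLM k m p => ?_⟩
  have hθ : (0 : ℝ) ≤ ((L : ℝ)⁻¹) ^ k := pow_nonneg (inv_nonneg.mpr (Nat.cast_nonneg _)) _
  let i : TorusIndex d L := ⟨M, hLM, k, m⟩
  have hpt : ∀ q : B4.Idx (pbox M) d, |covDiff L M k m p q|
      ≤ B₀ * Real.exp (-(δ₀ * pdist M (one_le_M M) (p.1 : Fin d → ℤ) (q.1 : Fin d → ℤ))) * ((L : ℝ)⁻¹) ^ k :=
    fun q => H i () p q trivial trivial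
  have hsum := bondSum_le (one_le_M M) hδ₀ p
  calc ∑ q : B4.Idx (pbox M) d, |covDiff L M k m p q|
      ≤ ∑ q : B4.Idx (pbox M) d,
          B₀ * Real.exp (-(δ₀ * pdist M (one_le_M M) (p.1 : Fin d → ℤ) (q.1 : Fin d → ℤ))) * ((L : ℝ)⁻¹) ^ k :=
        Finset.sum_le_sum fun q _ => hpt q
    _ = B₀ * ((L : ℝ)⁻¹) ^ k *
          ∑ q : B4.Idx (pbox M) d, Real.exp (-(δ₀ * pdist M (one_le_M M) (p.1 : Fin d → ℤ) (q.1 : Fin d → ℤ))) := by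
        rw [Finset.mul_sum]; refine Finset.sum_congr rfl fun q _ => ?_; ring
    _ ≤ B₀ * ((L : ℝ)⁻¹) ^ k * ((d : ℝ) * B4Sect5Proof.latticeConst d δ₀) :=
        mul_le_mul_of_nonneg_left hsum (by positivity)
    _ ≤ B₀ * ((L : ℝ)⁻¹) ^ k * V := mul_le_mul_of_nonneg_left (le_max_right _ _) (by positivity)
    _ = B₀ * V * ((L : ℝ)⁻¹) ^ k := by ring

/-- **THE ℓ^∞ → ℓ^∞ OPERATOR-NORM η-RATE of C^{(k)}(𝟙)** (d ≥ 2, L ≥ 1): with the same B₁(d, L), for every unit torus, all k, m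
and every function f on the bonds, `‖(C^{(L^{k+m})} − C^{(L^k)}) f‖_∞ ≤ B₁·(L⁻¹)^k·‖f‖_∞` (sup norms = the pi norms of
`bonds → ℝ`).  This is layer (L1) of `T4OperatorRateLiaison` (entrywise/row-sum ⇒ operator norm) for this species, with the
unit-site rate factor θ^k of layer (L2) — an operator η-rate at A = 0 as a THEOREM.
[cite: King1986, Lemma 4.5 (4.38) p.674 (shape)] [folklore] -/
theorem supNorm_rate_cov2156 (hd : 2 ≤ d) {L : ℕ} (hL : 1 ≤ L) :
    ∃ B₁ : ℝ, 0 < B₁ ∧ ∀ (M : Fin d → ℕ) [∀ μ, NeZero (M μ)], (∀ i, L ∣ M i) → ∀ (k m : ℕ)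
      (f : B4.Idx (pbox M) d → ℝ),
      ‖(fun p => ∑ q : B4.Idx (pbox M) d, covDiff L M k m p q * f q)‖ ≤ B₁ * ((L : ℝ)⁻¹) ^ k * ‖f‖ := by
  obtain ⟨B₁, hB₁, H⟩ := rowSum_rate_cov2156 (d := d) hd hL
  refine ⟨B₁, hB₁, fun M _ hLM k m f => ?_⟩
  have hθ : (0 : ℝ) ≤ ((L : ℝ)⁻¹) ^ k := pow_nonneg (inv_nonneg.mpr (Nat.cast_nonneg _)) _
  refine (pi_norm_le_iff_of_nonneg (by positivity)).mpr fun p => ?_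
  rw [Real.norm_eq_abs]
  calc |∑ q : B4.Idx (pbox M) d, covDiff L M k m p q * f q|
      ≤ ∑ q : B4.Idx (pbox M) d, |covDiff L M k m p q * f q| := Finset.abs_sum_le_sum_abs _ _
    _ = ∑ q : B4.Idx (pbox M) d, |covDiff L M k m p q| * |f q| := by simp_rw [abs_mul]
    _ ≤ ∑ q : B4.Idx (pbox M) d, |covDiff L M k m p q| * ‖f‖ :=
        Finset.sum_le_sum fun q _ => mul_le_mul_of_nonneg_left
          (by rw [← Real.norm_eq_abs]; exact norm_le_pi_norm f q) (abs_nonneg _)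
    _ = (∑ q : B4.Idx (pbox M) d, |covDiff L M k m p q|) * ‖f‖ := by rw [Finset.sum_mul]
    _ ≤ B₁ * ((L : ℝ)⁻¹) ^ k * ‖f‖ := mul_le_mul_of_nonneg_right (H M hLM k m p) (norm_nonneg _)

end Literature.MathematicalPhysics.QuantumFieldTheory.Balaban1983to89.T4EtaRateUnitWitness

end
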